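import Literature.MathematicalPhysics.QuantumFieldTheory.Balaban1983to89.B9Thm33GlobalBlockWitnessZdPer
import Literature.MathematicalPhysics.QuantumFieldTheory.Balaban1983to89.B9SupplySockB9P3ZdH2Per

/-!
# `Balaban1983to89.B9Thm33SocketUniformLevelsZdPer` — [Balaban1985RegularSpaces] (1.59) p. 86 ON THE TORUS `T_P` READ ON `ℤᵈ` FOR THE GENUINE RECORD:
# ONE constant set `(B₀′, B₀β′, c_P)` for ALL truncations `m′ ≤ K` of the periodic socket `SockB9P3Per` at lit-balaban's torus member `torusIdx` (the exact
# shape of the (B)-arrow hypothesis `∀ m′ ≤ K − n, SockB9P3Per P₀ L B₀ B₀β c_P β_H len η m′ {T_η} torusLam torusLamb` of lit-balaban t2s A17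
# `B8Thm2T3FamilyBinderSockPer.hThm2_of_core_sockPer`), obtained from FILE 3's per-truncation theorem by monotonicity of the socket in its constants and a
# maximum ∕ minimum over the finitely many truncations; plus the both-points (`H2`) editions

statement-level skeleton of published theorems with citation tags; proofs where landed; nothing here is a claim about the
Yang–Mills mass gap

`[Balaban1985RegularSpaces]` ("B8", CMP **98**) (1.58)–(1.59) p. 86, Prop. 3 p. 87, p. 77 *«we admit the case when some domains Ω_j are equal to T_η»*.
`[Balaban1985BackgroundPropagators]` ("B9", CMP **99**) Thm 3.3 p. 399, (3.45)∕(3.47) p. 398, Thm 3.11 p. 416 (the suppliers behind the socket).  PDF held: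
`paper:balaban1985-cmp99-background-propagators` pp. 398–399, 416.

CITATION HEADER (lean-in-tree rule).  Cell `pub-ymgap` (YM Track A), DAG node N06 = [B9], seat `pub-ymgap-dag-n06-b` (g24), the (β′-PERIODIC) road.  WHY:
FILE 3 (`B9Thm33GlobalBlockWitnessZdPer.sockB9P3Per_genuine_torusIdx_beta`) gives the socket at ONE truncation `m` with `m`-dependent constants
`(aI, aT, B₀)(m)`; the torus consumers (lit-balaban t2s A17; dag-n05-w1's `B8LeafModelZdPerProp3OfSockPer`) read the socket at ALL truncations `m′ ≤ K` with ONE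
constant set.  Since `SockB9P3Per` is MONOTONE in `B₀`, `B₀β` (its conclusions are `≤ B₀·(|J|₍₋₃₎ + |B₁|)`-type bounds with non-negative brackets) and ANTITONE in
`c_P` (dag-n06-b `sockB9P3Per_anti`), the finitely many constant sets combine by `max ∕ max ∕ min` (induction on `K`).  The `H2` (both-points Hölder class)
editions follow from g23's `holderAtIH2Per_iff_holderAtIPer_of_univ` (at `Ω_j = ℤᵈ` the two Hölder classes coincide).  Nothing is re-declared.

WHAT IS PROVED (kernel, 0 sorry; theorems only — no `def`, no `instance`, no `notation`).
* §1 `sockB9P3Per_mono` ∕ `sockB9P3H2Per_mono` (monotone in `B₀`, `B₀β`, antitone in `c_P`).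
* §2 ★★★★★ `sockB9P3Per_genuine_torusIdx_allLevels` (`Lᴷ ∣ P ⟹ ∃ B₀′ B₀β′ c_P, 0 < B₀′ ∧ 0 ≤ B₀β′ ∧ 0 < c_P ∧ ∀ m′ ≤ K, SockB9P3Per P L B₀′ B₀β′ c_P β len
  (torusIdx t).η m′ (torusIdx t).Ω (torusIdx t).Λs (torusIdx t).Λb` — the genuine record, any `0 ≤ β`, integer lengths; `2 ≤ d`, `2 ≤ L`, `1 ≤ M`).
* §3 ★★★ `sockB9P3H2Per_genuine_torusIdx_beta` (the both-points socket at one truncation), ★★★★ `sockB9P3H2Per_genuine_torusIdx_allLevels`.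

HONEST SCOPE.  (i) Bookkeeping over FILE 3: the constants are per-torus (compactness), NOT print's volume-uniform ones; no estimate of [B9] proved; the
Hölder line is the crude one of FILE 3 §7.  (ii) Count-neutral; N05 ∕ N06 NOT discharged; K1⁹ `stmt-QuantumFields-27364` NOT closed; one finite `𝕋⁴` programme
at fixed `ε`, Bałaban as printed; R4 closes only the conditional finite-`𝕋⁴` rung `BalabanLadder.UV` — nothing continuum ∕ ℝ⁴ ∕ OS ∕ mass gap ∕ Clay.  Unit
`pub-ymgap-dag-n06-b` (g24), 2026-08-28.
-/

noncomputable section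

namespace Literature.MathematicalPhysics.QuantumFieldTheory.Balaban1983to89.B9Thm33SocketUniformLevelsZdPer

open B7Prop1Explicit
open B7Prop2Explicit (unitaryUnits)
open B8ScaledSupNorm (bondNorm msup)
open B8Eq155JBound (wsup wsup_nonneg)
open B8LeafModelZd (ZdIdx)
open T4TermwiseTorus (IsPeriodic)
open B9SupplySockB9P3ZdLetters (OpsZd)
open B9Eq316AveragingTransposeZd (qQ betaTau)
open B9SupplySockB9P3ZdAllLettersZdPer (opsAllZdPer)
open B9SupplySockB9P3ZdH2Per (holderAtIH2Per_iff_holderAtIPer_of_univ sockB9P3H2Per_opsAllZdPer_of_binders)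
open B9Thm311ClassCompactnessZdPer (invAtHIPer_opsAllZdPer_torusIdx)
open B9Thm33GlobalBlockWitnessZdPer (globAtIPer_opsAllZdPer_torusIdx holderAtIPer_of_globAtIPer_of_len gop_isPeriodic_opsAllZdPer' levelSepPP0_torusIdx'
  sockB9P3Per_genuine_torusIdx_beta)
open B8Thm4TorusAt (torusLam)
open B8Thm2TorusMember (TorusMember torusIdx torusLamb)
open B8LeafModelZd3SockPer (SockB9P3Per sockB9P3Per_anti)
open B8LeafModelZd3SockH2Per (SockB9P3H2Per sockB9P3H2Per_anti)

-- `Site` alone could resolve to the torus sites of `Setup.lean`; re-export the `ℤ^d` sites of `B7Prop1Explicit`.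
export B7Prop1Explicit (Site)

variable {d : ℕ} {𝔸 : Type*} [CStarAlgebra 𝔸]

/-! ## §1  Monotonicity of the periodic sockets in their constants -/

section Mono

/-- **`SockB9P3Per` IS MONOTONE IN `B₀`, `B₀β` AND ANTITONE IN `c_P`**: its five conclusion lines are `≤ B₀·S` ∕ `≤ B₀β·S` with `S = |J|₍₋₃₎ + |B₁| ≥ 0`, its
threshold clauses are `α₀, α₂ ≤ c_P`. [cite: Balaban1985RegularSpaces, (1.59) p.86 (bookkeeping)] -/
theorem sockB9P3Per_mono {P L : ℕ} {B₀ B₀' B₀β B₀β' cP cP' β : ℝ} {len : Site d → ℝ} (hB : B₀ ≤ B₀') (hBβ : B₀β ≤ B₀β') (hc : cP' ≤ cP)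
    {η : ℝ} (hη : 0 ≤ η) {k : ℕ} {Ω : ℕ → Set (Site d)} {Λs : ℕ → ℕ → Set (Site d)} {Λb : ℕ → ℕ → Set (Site d × Fin d)}
    (S : SockB9P3Per (𝔸 := 𝔸) P L B₀ B₀β cP β len η k Ω Λs Λb) : SockB9P3Per (𝔸 := 𝔸) P L B₀' B₀β' cP' β len η k Ω Λs Λb := by
  intro α₀ α₂ hα₀ hα₀c hα₂ hα₂c U₀ W hU₀ hW hU₀p hWp hInU hInW hLan A' hsa hA'p hexp hoff
  obtain ⟨h1, h2, h3, h4, h5⟩ := S α₀ α₂ hα₀ (hα₀c.trans hc) hα₂ (hα₂c.trans hc) U₀ W hU₀ hW hU₀p hWp hInU hInW hLan A' hsa hA'p hexp hoff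
  have hS : 0 ≤ bondNorm L k η (-(3 : ℝ)) Ω (fun x μ => B8Eq155JBound.Jcur η U₀ A' μ x) +
      wsup 1 (fun p : {p : ℕ × (Site d × Fin d) // p.1 ≤ k ∧ p.2 ∈ Λb k p.1} =>
        B7Prop4GeneralLevels.linCovIter L U₀ (B8Eq146AExpansion.iEta η A') p.1.1 p.1.2.1 p.1.2.2) :=
    add_nonneg (B8ScaledSupNorm.msup_nonneg L k hη _ _ _) (wsup_nonneg zero_le_one _)
  exact ⟨h1.trans (mul_le_mul_of_nonneg_right hB hS), h2.trans (mul_le_mul_of_nonneg_right hB hS), h3.trans (mul_le_mul_of_nonneg_right hB hS),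
    h4.trans (mul_le_mul_of_nonneg_right hB hS), h5.trans (mul_le_mul_of_nonneg_right hBβ hS)⟩

/-- **`SockB9P3H2Per` IS MONOTONE IN `B₀`, `B₀β` AND ANTITONE IN `c_P`** (same reason). [cite: Balaban1985RegularSpaces, (1.59) p.86 (bookkeeping)] -/
theorem sockB9P3H2Per_mono {P L : ℕ} {B₀ B₀' B₀β B₀β' cP cP' β : ℝ} {len : Site d → ℝ} (hB : B₀ ≤ B₀') (hBβ : B₀β ≤ B₀β') (hc : cP' ≤ cP)
    {η : ℝ} (hη : 0 ≤ η) {k : ℕ} {Ω : ℕ → Set (Site d)} {Λs : ℕ → ℕ → Set (Site d)} {Λb : ℕ → ℕ → Set (Site d × Fin d)}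
    (S : SockB9P3H2Per (𝔸 := 𝔸) P L B₀ B₀β cP β len η k Ω Λs Λb) : SockB9P3H2Per (𝔸 := 𝔸) P L B₀' B₀β' cP' β len η k Ω Λs Λb := by
  intro α₀ α₂ hα₀ hα₀c hα₂ hα₂c U₀ W hU₀ hW hU₀p hWp hInU hInW hLan A' hsa hA'p hexp hoff
  obtain ⟨h1, h2, h3, h4, h5⟩ := S α₀ α₂ hα₀ (hα₀c.trans hc) hα₂ (hα₂c.trans hc) U₀ W hU₀ hW hU₀p hWp hInU hInW hLan A' hsa hA'p hexp hoff
  have hS : 0 ≤ bondNorm L k η (-(3 : ℝ)) Ω (fun x μ => B8Eq155JBound.Jcur η U₀ A' μ x) +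
      wsup 1 (fun p : {p : ℕ × (Site d × Fin d) // p.1 ≤ k ∧ p.2 ∈ Λb k p.1} =>
        B7Prop4GeneralLevels.linCovIter L U₀ (B8Eq146AExpansion.iEta η A') p.1.1 p.1.2.1 p.1.2.2) :=
    add_nonneg (B8ScaledSupNorm.msup_nonneg L k hη _ _ _) (wsup_nonneg zero_le_one _)
  exact ⟨h1.trans (mul_le_mul_of_nonneg_right hB hS), h2.trans (mul_le_mul_of_nonneg_right hB hS), h3.trans (mul_le_mul_of_nonneg_right hB hS),
    h4.trans (mul_le_mul_of_nonneg_right hB hS), h5.trans (mul_le_mul_of_nonneg_right hBβ hS)⟩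

end Mono

/-! ## §2  One constant set for all truncations `m′ ≤ K` at the torus member -/

section AllLevels

variable [FiniteDimensional ℝ 𝔸] [Nontrivial 𝔸] (τ : 𝔸 →ₗ[ℂ] ℂ) (hτp : ∀ a : 𝔸, a ≠ 0 → 0 < (τ (star a * a)).re)
  (hτt : ∀ a b : 𝔸, τ (a * b) = τ (b * a)) (hτs : ∀ a : 𝔸, τ (star a) = starRingEnd ℂ (τ a)) {L P : ℕ} [NeZero P] [NeZero L]

include hτp hτt hτs in
/-- **THE SOCKET AT ONE TRUNCATION WITH GENERIC POSITIVE CONSTANTS** (FILE 3's `sockB9P3Per_genuine_torusIdx_beta`, the explicit constants forgotten):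
`Lᵐ ∣ P ⟹ ∃ B₀′ > 0, ∃ B₀β′ ≥ 0, ∃ c_P > 0, SockB9P3Per P L B₀′ B₀β′ c_P β len (torusIdx t).η m …`.
[cite: Balaban1985RegularSpaces, (1.59) p.86, Prop. 3 p.87, p.77 («Ω_j = T_η»); Balaban1985BackgroundPropagators, Thm 3.3 p.399, Thm 3.11 p.416] -/
theorem sockB9P3Per_genuine_torusIdx_exists (hd2 : 2 ≤ d) (hL2 : 2 ≤ L)
    {Cτ : ℝ} (hCτ : ∀ x y : 𝔸, |(τ (star x * y)).re| ≤ Cτ * ‖x‖ * ‖y‖)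
    (t : TorusMember) (ops₀ : ℝ → ZdIdx d L → ℕ → OpsZd d 𝔸) {M : ℝ} (hM1 : 1 ≤ M) (m : ℕ) (hP : L ^ m ∣ P)
    {β : ℝ} (hβ : 0 ≤ β) {len : Site d → ℝ} (hlen : ∀ v : Site d, 0 < len v → 1 ≤ len v) :
    ∃ B₀' : ℝ, 0 < B₀' ∧ ∃ B₀β' : ℝ, 0 ≤ B₀β' ∧ ∃ cP : ℝ, 0 < cP ∧
      SockB9P3Per (𝔸 := 𝔸) P L B₀' B₀β' cP β len
        (torusIdx (d := d) (le_trans (by norm_num) hL2) t).η m (torusIdx (d := d) (le_trans (by norm_num) hL2) t).Ω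
        (torusIdx (d := d) (le_trans (by norm_num) hL2) t).Λs (torusIdx (d := d) (le_trans (by norm_num) hL2) t).Λb := by
  obtain ⟨aI, haI, aT, haT, B₀, hB₀, hS⟩ := sockB9P3Per_genuine_torusIdx_beta τ hτp hτt hτs hd2 hL2 hCτ t ops₀ hM1 m hP hβ hlen
  refine ⟨_, lt_of_lt_of_le zero_lt_one (le_max_left _ _), _, ?_, _, ?_, hS⟩
  · have : 0 ≤ ((L : ℝ) ^ m) ^ β := Real.rpow_nonneg (by positivity) β
    have : 0 ≤ max 0 (2 * B₀ * ((L : ℝ) ^ m) ^ β) := le_max_left _ _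
    positivity
  · have hd1 : 0 ≤ (14 : ℝ) * ((d - 1 : ℕ) : ℝ) := by positivity
    have : 0 < 2 * B₀ * (14 * ((d - 1 : ℕ) : ℝ)) * M + 1 := by
      have : 0 ≤ 2 * B₀ * (14 * ((d - 1 : ℕ) : ℝ)) * M := by
        have hM0 : 0 ≤ M := le_trans zero_le_one hM1
        positivity
      linarith
    exact lt_min (by norm_num) (lt_min haI (lt_min haT (by positivity)))

include hτp hτt hτs in
/-- ★★★★★ **[B8] (1.59) ON THE TORUS FOR THE GENUINE RECORD WITH ONE CONSTANT SET FOR ALL TRUNCATIONS `m′ ≤ K`** — the exact shape of the (B)-arrow hypothesis of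
lit-balaban t2s A17 `hThm2_of_core_sockPer` (`∀ m′ ≤ K − n, SockB9P3Per P₀ L B₀ B₀β c_P β_H len η m′ {T_η} torusLam torusLamb`): for `2 ≤ d`, `2 ≤ L`, `Lᴷ ∣ P`, a
block parameter `M ≥ 1`, a faithful Hermitian tracial `τ` with `|Re τ(x*y)| ≤ C_τ‖x‖‖y‖` on a finite-dimensional non-trivial fibre, any `0 ≤ β` and any length with
`len v ≥ 1` whenever `len v > 0`: `∃ B₀′ > 0, B₀β′ ≥ 0, c_P > 0` such that for EVERY `m′ ≤ K`, `SockB9P3Per P L B₀′ B₀β′ c_P β len (torusIdx t).η m′ (torusIdx t).Ω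
(torusIdx t).Λs (torusIdx t).Λb` — NO binder of Bałaban's displayed (Thm 3.11 ∕ Thm 3.3's (3.47)@−3 ∕ (3.45) per member by compactness, FILES 2–3); the constants
are per-torus.  Induction on `K` with §1's monotonicity.
[cite: Balaban1985RegularSpaces, (1.58)–(1.59) p.86, Prop. 3 p.87, Thm 2 p.83, p.77 («Ω_j = T_η»); Balaban1985BackgroundPropagators, Thm 3.3 p.399, (3.45), (3.47) p.398, (3.27) p.395, Thm 3.11 p.416] -/
theorem sockB9P3Per_genuine_torusIdx_allLevels (hd2 : 2 ≤ d) (hL2 : 2 ≤ L)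
    {Cτ : ℝ} (hCτ : ∀ x y : 𝔸, |(τ (star x * y)).re| ≤ Cτ * ‖x‖ * ‖y‖)
    (t : TorusMember) (ops₀ : ℝ → ZdIdx d L → ℕ → OpsZd d 𝔸) {M : ℝ} (hM1 : 1 ≤ M) {K : ℕ} (hPK : L ^ K ∣ P)
    {β : ℝ} (hβ : 0 ≤ β) {len : Site d → ℝ} (hlen : ∀ v : Site d, 0 < len v → 1 ≤ len v) :
    ∃ B₀' : ℝ, 0 < B₀' ∧ ∃ B₀β' : ℝ, 0 ≤ B₀β' ∧ ∃ cP : ℝ, 0 < cP ∧ ∀ m', m' ≤ K →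
      SockB9P3Per (𝔸 := 𝔸) P L B₀' B₀β' cP β len
        (torusIdx (d := d) (le_trans (by norm_num) hL2) t).η m' (torusIdx (d := d) (le_trans (by norm_num) hL2) t).Ω
        (torusIdx (d := d) (le_trans (by norm_num) hL2) t).Λs (torusIdx (d := d) (le_trans (by norm_num) hL2) t).Λb := by
  have hη : 0 ≤ (torusIdx (d := d) (le_trans (by norm_num) hL2) t).η := t.hη.le
  have h0 : L ^ 0 ∣ P := by rw [pow_zero]; exact one_dvd P
  induction K with
  | zero =>
    obtain ⟨B₀', hB₀', B₀β', hB₀β', cP, hcP, hS⟩ := sockB9P3Per_genuine_torusIdx_exists τ hτp hτt hτs hd2 hL2 hCτ t ops₀ hM1 0 h0 hβ hlen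
    exact ⟨B₀', hB₀', B₀β', hB₀β', cP, hcP, fun m' hm' => by rw [Nat.le_zero.1 hm']; exact hS⟩
  | succ K ih =>
    obtain ⟨B₁, hB₁, Bβ₁, hBβ₁, c₁, hc₁, hS₁⟩ := ih (dvd_trans (pow_dvd_pow L K.le_succ) hPK)
    obtain ⟨B₂, hB₂, Bβ₂, hBβ₂, c₂, hc₂, hS₂⟩ :=
      sockB9P3Per_genuine_torusIdx_exists τ hτp hτt hτs hd2 hL2 hCτ t ops₀ hM1 (K + 1) hPK hβ hlen
    refine ⟨max B₁ B₂, lt_max_of_lt_left hB₁, max Bβ₁ Bβ₂, le_max_of_le_left hBβ₁, min c₁ c₂, lt_min hc₁ hc₂, fun m' hm' => ?_⟩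
    rcases Nat.lt_or_eq_of_le hm' with hlt | rfl
    · exact sockB9P3Per_mono (le_max_left _ _) (le_max_left _ _) (min_le_left _ _) hη (hS₁ m' (Nat.lt_succ_iff.1 hlt))
    · exact sockB9P3Per_mono (le_max_right _ _) (le_max_right _ _) (min_le_right _ _) hη hS₂

end AllLevels

/-! ## §3  The both-points (`H2`) editions -/

section H2

variable [FiniteDimensional ℝ 𝔸] [Nontrivial 𝔸] (τ : 𝔸 →ₗ[ℂ] ℂ) (hτp : ∀ a : 𝔸, a ≠ 0 → 0 < (τ (star a * a)).re)
  (hτt : ∀ a b : 𝔸, τ (a * b) = τ (b * a)) (hτs : ∀ a : 𝔸, τ (star a) = starRingEnd ℂ (τ a)) {L P : ℕ} [NeZero P] [NeZero L]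

include hτp hτt hτs in
/-- ★★★ **THE BOTH-POINTS PERIODIC SOCKET `SockB9P3H2Per` FOR THE GENUINE RECORD AT THE TORUS MEMBER, ONE TRUNCATION, ANY `0 ≤ β`** (integer lengths) — at
`Ω_j = ℤᵈ` the both-points Hölder binder coincides with the first-point one (g23 `holderAtIH2Per_iff_holderAtIPer_of_univ`), so FILE 3's per-member binders feed
`sockB9P3H2Per_opsAllZdPer_of_binders` as well; NO binder of Bałaban's left.
[cite: Balaban1985RegularSpaces, (1.58)–(1.59) p.86, Prop. 3 p.87, p.77 («Ω_j = T_η»); Balaban1985BackgroundPropagators, Thm 3.3 p.399, (3.45), (3.47) p.398, (3.27) p.395, Thm 3.11 p.416] -/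
theorem sockB9P3H2Per_genuine_torusIdx_beta (hd2 : 2 ≤ d) (hL2 : 2 ≤ L)
    {Cτ : ℝ} (hCτ : ∀ x y : 𝔸, |(τ (star x * y)).re| ≤ Cτ * ‖x‖ * ‖y‖)
    (t : TorusMember) (ops₀ : ℝ → ZdIdx d L → ℕ → OpsZd d 𝔸) {M : ℝ} (hM1 : 1 ≤ M) (m : ℕ) (hP : L ^ m ∣ P)
    {β : ℝ} (hβ : 0 ≤ β) {len : Site d → ℝ} (hlen : ∀ v : Site d, 0 < len v → 1 ≤ len v) :
    ∃ aI : ℝ, 0 < aI ∧ ∃ aT : ℝ, 0 < aT ∧ ∃ B₀ : ℝ, 0 < B₀ ∧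
      SockB9P3H2Per (𝔸 := 𝔸) P L (max 1 (2 * B₀ * max 1 (qQ d L Cτ (betaTau τ) 0)))
        (2 * max 0 (2 * B₀ * (((L : ℝ) ^ m) ^ β)) * max 1 (qQ d L Cτ (betaTau τ) 0))
        (min (1 / 16) (min aI (min aT (1 / (2 * B₀ * (14 * ((d - 1 : ℕ) : ℝ)) * M + 1))))) β len
        (torusIdx (d := d) (le_trans (by norm_num) hL2) t).η m (torusIdx (d := d) (le_trans (by norm_num) hL2) t).Ω
        (torusIdx (d := d) (le_trans (by norm_num) hL2) t).Λs (torusIdx (d := d) (le_trans (by norm_num) hL2) t).Λb := by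
  have hL1 : 1 ≤ L := le_trans (by norm_num) hL2
  have hd : 0 < d := lt_of_lt_of_le (by norm_num) hd2
  obtain ⟨aI, haI, hinv⟩ := invAtHIPer_opsAllZdPer_torusIdx τ hτp hτt hτs hd hL2 t ops₀ M m hP
  obtain ⟨aT, haT, B₀, hB₀, hglob⟩ := globAtIPer_opsAllZdPer_torusIdx τ hτp hτt hτs hd hL2 hCτ t ops₀ M m hP
  have hhol := holderAtIPer_of_globAtIPer_of_len (P := P) hd2 hL1 (i := torusIdx (d := d) hL1 t) (fun _ => rfl) hB₀.le
    (fun U₀ J _ _ => gop_isPeriodic_opsAllZdPer' τ (fun m => torusLamb (d := d) m) ops₀ M _ m U₀ J) hβ hlen hglob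
  have hhol2 := (holderAtIH2Per_iff_holderAtIPer_of_univ (P := P) (L := L) (ops := opsAllZdPer τ L P (fun m => torusLamb (d := d) m) ops₀)
    (i := torusIdx (d := d) hL1 t) (fun _ => rfl)).2 hhol
  refine ⟨aI, haI, aT, haT, B₀, hB₀, ?_⟩
  exact sockB9P3H2Per_opsAllZdPer_of_binders L τ P hd2 hL2 hτp hτt hτs hCτ ops₀ hM1 (torusIdx (d := d) hL1 t) rfl hP
    (fun j _ κ => B9Thm311FlatPositivityZdPer.isPeriodic_mem_torusLamb (P / L ^ j) m j κ) (levelSepPP0_torusIdx' hL1 t m) hinv hglob hhol2 hB₀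

include hτp hτt hτs in
/-- ★★★★ **THE BOTH-POINTS SOCKET WITH ONE CONSTANT SET FOR ALL TRUNCATIONS `m′ ≤ K`** (same hypotheses as `sockB9P3Per_genuine_torusIdx_allLevels`).
[cite: Balaban1985RegularSpaces, (1.58)–(1.59) p.86, Prop. 3 p.87, p.77 («Ω_j = T_η»); Balaban1985BackgroundPropagators, Thm 3.3 p.399, Thm 3.11 p.416] -/
theorem sockB9P3H2Per_genuine_torusIdx_allLevels (hd2 : 2 ≤ d) (hL2 : 2 ≤ L)
    {Cτ : ℝ} (hCτ : ∀ x y : 𝔸, |(τ (star x * y)).re| ≤ Cτ * ‖x‖ * ‖y‖)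
    (t : TorusMember) (ops₀ : ℝ → ZdIdx d L → ℕ → OpsZd d 𝔸) {M : ℝ} (hM1 : 1 ≤ M) {K : ℕ} (hPK : L ^ K ∣ P)
    {β : ℝ} (hβ : 0 ≤ β) {len : Site d → ℝ} (hlen : ∀ v : Site d, 0 < len v → 1 ≤ len v) :
    ∃ B₀' : ℝ, 0 < B₀' ∧ ∃ B₀β' : ℝ, 0 ≤ B₀β' ∧ ∃ cP : ℝ, 0 < cP ∧ ∀ m', m' ≤ K →
      SockB9P3H2Per (𝔸 := 𝔸) P L B₀' B₀β' cP β len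
        (torusIdx (d := d) (le_trans (by norm_num) hL2) t).η m' (torusIdx (d := d) (le_trans (by norm_num) hL2) t).Ω
        (torusIdx (d := d) (le_trans (by norm_num) hL2) t).Λs (torusIdx (d := d) (le_trans (by norm_num) hL2) t).Λb := by
  have hη : 0 ≤ (torusIdx (d := d) (le_trans (by norm_num) hL2) t).η := t.hη.le
  -- the per-truncation statement with generic constants
  have hone : ∀ m : ℕ, L ^ m ∣ P → ∃ B₀' : ℝ, 0 < B₀' ∧ ∃ B₀β' : ℝ, 0 ≤ B₀β' ∧ ∃ cP : ℝ, 0 < cP ∧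
      SockB9P3H2Per (𝔸 := 𝔸) P L B₀' B₀β' cP β len
        (torusIdx (d := d) (le_trans (by norm_num) hL2) t).η m (torusIdx (d := d) (le_trans (by norm_num) hL2) t).Ω
        (torusIdx (d := d) (le_trans (by norm_num) hL2) t).Λs (torusIdx (d := d) (le_trans (by norm_num) hL2) t).Λb := by
    intro m hP
    obtain ⟨aI, haI, aT, haT, B₀, hB₀, hS⟩ := sockB9P3H2Per_genuine_torusIdx_beta τ hτp hτt hτs hd2 hL2 hCτ t ops₀ hM1 m hP hβ hlen
    refine ⟨_, lt_of_lt_of_le zero_lt_one (le_max_left _ _), _, ?_, _, ?_, hS⟩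
    · have : 0 ≤ ((L : ℝ) ^ m) ^ β := Real.rpow_nonneg (by positivity) β
      have : 0 ≤ max 0 (2 * B₀ * ((L : ℝ) ^ m) ^ β) := le_max_left _ _
      positivity
    · have : 0 < 2 * B₀ * (14 * ((d - 1 : ℕ) : ℝ)) * M + 1 := by
        have : 0 ≤ 2 * B₀ * (14 * ((d - 1 : ℕ) : ℝ)) * M := by
          have hM0 : 0 ≤ M := le_trans zero_le_one hM1
          positivity
        linarith
      exact lt_min (by norm_num) (lt_min haI (lt_min haT (by positivity)))
  have h0 : L ^ 0 ∣ P := by rw [pow_zero]; exact one_dvd P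
  induction K with
  | zero =>
    obtain ⟨B₀', hB₀', B₀β', hB₀β', cP, hcP, hS⟩ := hone 0 h0
    exact ⟨B₀', hB₀', B₀β', hB₀β', cP, hcP, fun m' hm' => by rw [Nat.le_zero.1 hm']; exact hS⟩
  | succ K ih =>
    obtain ⟨B₁, hB₁, Bβ₁, hBβ₁, c₁, hc₁, hS₁⟩ := ih (dvd_trans (pow_dvd_pow L K.le_succ) hPK)
    obtain ⟨B₂, hB₂, Bβ₂, hBβ₂, c₂, hc₂, hS₂⟩ := hone (K + 1) hPK
    refine ⟨max B₁ B₂, lt_max_of_lt_left hB₁, max Bβ₁ Bβ₂, le_max_of_le_left hBβ₁, min c₁ c₂, lt_min hc₁ hc₂, fun m' hm' => ?_⟩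
    rcases Nat.lt_or_eq_of_le hm' with hlt | rfl
    · exact sockB9P3H2Per_mono (le_max_left _ _) (le_max_left _ _) (min_le_left _ _) hη (hS₁ m' (Nat.lt_succ_iff.1 hlt))
    · exact sockB9P3H2Per_mono (le_max_right _ _) (le_max_right _ _) (min_le_right _ _) hη hS₂

end H2

end Literature.MathematicalPhysics.QuantumFieldTheory.Balaban1983to89.B9Thm33SocketUniformLevelsZdPer

end
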